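import Summits.FinalStateConjecture.FinalStateConjecture.Theorems.PhotonSphereChannelsEnergyInequalities

/-!
# Route PhotonSphereChannels — the weighted null-energy estimate on a box, from the weighted transport
# identity (open-interval repulsivity hypotheses)

Helper file for sub-goal `stub_compactExhaustionOfLocalDecay` of stub H4 of line `isolated-kerr-connected-hull`
(crux stmt-FinalStateConjecture-14075), companion of `…RWeightedTransport` (whose `weighted_box_estimate` asks
the repulsivity inequality on CLOSED intervals — unusable at the centre, where the weight vanishes).  Given a
`C²` function `u`, `V ∈ C¹`, `V ≥ 0`, a sign `κ`, a weight `w ∈ C¹` and the conclusion of the weighted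
transport identity on `[0, T] × [p, q]` with vanishing boundary terms,
`∫_p^q w e_κ(T,·) − ∫_p^q w e_κ(0,·) = ∫_0^T ∫_p^q κ[(wV′ + w′V)u² − w′(u_t + κu_x)²]` (hypothesis `hkey`;
`e_κ = (u_t + κu_x)² + Vu²`), and `p ≤ m₁ ≤ m₂ ≤ q` with `w ≥ 0`, `κw′ ≥ c > 0` on `[p, q]`,
`cV ≤ −κ(wV′ + w′V)` on `(p, m₁) ∪ (m₂, q)`, `−κ(wV′ + w′V) ≥ −C` on `(m₁, m₂)`, `V ≤ V₁` on `[m₁, m₂]`,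
`∫_0^T ∫_{m₁}^{m₂} u² ≤ K`:  `∫_0^T ∫_p^q ((u_t + κu_x)² + Vu²) ≤ (∫_p^q w e_κ(0,·) + (C + cV₁)K)/c`
(`weighted_box_estimate_Ioo`).  Plus bookkeeping for iterated interval integrals of continuous functions over
boxes (`integral2_*`; the six lemmas shared with `…RWeightedTransport` are re-derived here as `private`
copies so that this file does not depend on that module's build).  No definitions. [folklore]
-/

namespace Summit.FinalStateConjecture.FinalStateConjecture.Theorems

-- every `Summit.FinalStateConjecture.FinalStateConjecture.…` name repeats the summit = sub-problem
-- segment (D-0017 layout), as in every landed `…Theorems` file of this route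
set_option linter.dupNamespace false

open MeasureTheory Set Filter Topology intervalIntegral

noncomputable section

namespace WaveEnergy

section DoubleIntegral

variable {g h : ℝ × ℝ → ℝ}

/-- Slices of a continuous function on `ℝ × ℝ` are interval integrable (private copy). -/
private theorem intervalIntegrable_slice₀ (hg : Continuous g) (t p q : ℝ) :
    IntervalIntegrable (fun x => g (t, x)) volume p q :=
  (hg.comp (Continuous.prodMk_right t)).intervalIntegrable p q

/-- The inner integral of a continuous function is continuous in the outer variable (private copy). -/
private theorem continuous_inner_integral₀ (hg : Continuous g) (p q : ℝ) :
    Continuous fun t => ∫ x in p..q, g (t, x) :=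
  intervalIntegral.continuous_parametric_intervalIntegral_of_continuous' (f := fun t x => g (t, x))
    (hg.comp (continuous_fst.prodMk continuous_snd)) p q

/-- Box integrals of continuous functions are monotone under a pointwise bound on `[0, T] × (p, q)`
(`0 ≤ T`, `p ≤ q`; the bound is only needed on the OPEN `x`-interval). -/
theorem integral2_mono_on_Ioo (hg : Continuous g) (hh : Continuous h) {T p q : ℝ} (hT : 0 ≤ T)
    (hpq : p ≤ q) (hle : ∀ t ∈ Icc 0 T, ∀ x ∈ Ioo p q, g (t, x) ≤ h (t, x)) :
    (∫ t in (0 : ℝ)..T, ∫ x in p..q, g (t, x)) ≤ ∫ t in (0 : ℝ)..T, ∫ x in p..q, h (t, x) :=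
  intervalIntegral.integral_mono_on hT ((continuous_inner_integral₀ hg p q).intervalIntegrable _ _)
    ((continuous_inner_integral₀ hh p q).intervalIntegrable _ _) fun t ht =>
      intervalIntegral.integral_mono_on_of_le_Ioo hpq (intervalIntegrable_slice₀ hg t p q)
        (intervalIntegrable_slice₀ hh t p q) fun x hx => hle t ht x hx

/-- Splitting the box integral at `x = m` (private copy). -/
private theorem integral2_split₀ (hg : Continuous g) (T p m q : ℝ) :
    (∫ t in (0 : ℝ)..T, ∫ x in p..q, g (t, x))
      = (∫ t in (0 : ℝ)..T, ∫ x in p..m, g (t, x)) + ∫ t in (0 : ℝ)..T, ∫ x in m..q, g (t, x) := by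
  rw [← intervalIntegral.integral_add ((continuous_inner_integral₀ hg p m).intervalIntegrable _ _)
    ((continuous_inner_integral₀ hg m q).intervalIntegrable _ _)]
  exact intervalIntegral.integral_congr fun t _ =>
    (intervalIntegral.integral_add_adjacent_intervals (intervalIntegrable_slice₀ hg t p m)
      (intervalIntegrable_slice₀ hg t m q)).symm

/-- Additivity of the box integral (private copy). -/
private theorem integral2_add₀ (hg : Continuous g) (hh : Continuous h) (T p q : ℝ) :
    (∫ t in (0 : ℝ)..T, ∫ x in p..q, (g (t, x) + h (t, x)))
      = (∫ t in (0 : ℝ)..T, ∫ x in p..q, g (t, x)) + ∫ t in (0 : ℝ)..T, ∫ x in p..q, h (t, x) := by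
  rw [← intervalIntegral.integral_add ((continuous_inner_integral₀ hg p q).intervalIntegrable _ _)
    ((continuous_inner_integral₀ hh p q).intervalIntegrable _ _)]
  exact intervalIntegral.integral_congr fun t _ =>
    intervalIntegral.integral_add (intervalIntegrable_slice₀ hg t p q) (intervalIntegrable_slice₀ hh t p q)

/-- Constants come out of the box integral (private copy). -/
private theorem integral2_const_mul₀ (c T p q : ℝ) :
    (∫ t in (0 : ℝ)..T, ∫ x in p..q, c * g (t, x)) = c * ∫ t in (0 : ℝ)..T, ∫ x in p..q, g (t, x) := by
  rw [← intervalIntegral.integral_const_mul]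
  exact intervalIntegral.integral_congr fun t _ => intervalIntegral.integral_const_mul c _

/-- The box integral of a non-negative function is non-negative (`0 ≤ T`, `p ≤ q`). -/
theorem integral2_nonneg (hg0 : ∀ z, 0 ≤ g z) {T p q : ℝ} (hT : 0 ≤ T) (hpq : p ≤ q) :
    0 ≤ ∫ t in (0 : ℝ)..T, ∫ x in p..q, g (t, x) :=
  intervalIntegral.integral_nonneg hT fun _ _ => intervalIntegral.integral_nonneg hpq fun _ _ => hg0 _

/-- The box integral of a non-negative continuous function grows with the right end `q`. -/
theorem integral2_mono_right (hg : Continuous g) (hg0 : ∀ z, 0 ≤ g z) {T p q q' : ℝ} (hT : 0 ≤ T)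
    (hpq : p ≤ q) (hqq' : q ≤ q') :
    (∫ t in (0 : ℝ)..T, ∫ x in p..q, g (t, x)) ≤ ∫ t in (0 : ℝ)..T, ∫ x in p..q', g (t, x) :=
  intervalIntegral.integral_mono_on hT ((continuous_inner_integral₀ hg p q).intervalIntegrable _ _)
    ((continuous_inner_integral₀ hg p q').intervalIntegrable _ _) fun t _ =>
      intervalIntegral.integral_mono_interval le_rfl hpq hqq'
        (Eventually.of_forall fun _ => hg0 _) (intervalIntegrable_slice₀ hg t p q')

/-- The box integral of a non-negative continuous function grows as the left end `p` decreases. -/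
theorem integral2_mono_left (hg : Continuous g) (hg0 : ∀ z, 0 ≤ g z) {T p p' q : ℝ} (hT : 0 ≤ T)
    (hpp' : p' ≤ p) (hpq : p ≤ q) :
    (∫ t in (0 : ℝ)..T, ∫ x in p..q, g (t, x)) ≤ ∫ t in (0 : ℝ)..T, ∫ x in p'..q, g (t, x) :=
  intervalIntegral.integral_mono_on hT ((continuous_inner_integral₀ hg p q).intervalIntegrable _ _)
    ((continuous_inner_integral₀ hg p' q).intervalIntegrable _ _) fun t _ =>
      intervalIntegral.integral_mono_interval hpp' hpq le_rfl
        (Eventually.of_forall fun _ => hg0 _) (intervalIntegrable_slice₀ hg t p' q)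

/-- The box integral of a non-negative continuous function grows with `T`. -/
theorem integral2_mono_time (hg : Continuous g) (hg0 : ∀ z, 0 ≤ g z) {T T' p q : ℝ} (hT : 0 ≤ T)
    (hTT' : T ≤ T') (hpq : p ≤ q) :
    (∫ t in (0 : ℝ)..T, ∫ x in p..q, g (t, x)) ≤ ∫ t in (0 : ℝ)..T', ∫ x in p..q, g (t, x) :=
  intervalIntegral.integral_mono_interval le_rfl hT hTT'
    (Eventually.of_forall fun _ => intervalIntegral.integral_nonneg hpq fun _ _ => hg0 _)
    ((continuous_inner_integral₀ hg p q).intervalIntegrable _ _)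

end DoubleIntegral

variable {u : ℝ × ℝ → ℝ} {V : ℝ → ℝ} {κ : ℝ}

/-- **Weighted null-energy estimate on a box** (from the weighted transport identity, hypothesis `hkey`).
`u ∈ C²`, `V ∈ C¹`, `V ≥ 0`, `e_κ = (u_t + κu_x)² + Vu²`, `w ∈ C¹`; `p ≤ m₁ ≤ m₂ ≤ q`, `0 ≤ T`; `w ≥ 0` and
`κw′ ≥ c > 0` on `[p, q]`; repulsive ends `cV ≤ −κ(wV′ + w′V)` on `(p, m₁) ∪ (m₂, q)`; `−κ(wV′ + w′V) ≥ −C`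
on `(m₁, m₂)`, `V ≤ V₁` on `[m₁, m₂]`, `∫_0^T ∫_{m₁}^{m₂} u² ≤ K`.  Then
`∫_0^T ∫_p^q ((u_t + κu_x)² + Vu²) ≤ (∫_p^q w e_κ(0,·) + (C + cV₁)K)/c`. [folklore] -/
theorem weighted_box_estimate_Ioo (hu : ContDiff ℝ 2 u) (hV : ContDiff ℝ 1 V) (hV0 : ∀ x, 0 ≤ V x)
    {eκ : ℝ × ℝ → ℝ}
    (heκ : ∀ z, eκ z = (fderiv ℝ u z (1, 0) + κ * fderiv ℝ u z (0, 1)) ^ 2 + V z.2 * u z ^ 2)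
    {w w' : ℝ → ℝ} (hw : ∀ x, HasDerivAt w (w' x) x) (hw' : Continuous w')
    {p m₁ m₂ q T c C V₁ K : ℝ} (hpm : p ≤ m₁) (hm : m₁ ≤ m₂) (hmq : m₂ ≤ q) (hT : 0 ≤ T)
    (hkey : (∫ x in p..q, w x * eκ (T, x)) - ∫ x in p..q, w x * eκ (0, x)
      = ∫ t in (0 : ℝ)..T, ∫ x in p..q, κ * ((w x * deriv V x + w' x * V x) * u (t, x) ^ 2
          - w' x * (fderiv ℝ u (t, x) (1, 0) + κ * fderiv ℝ u (t, x) (0, 1)) ^ 2))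
    (hw0 : ∀ x ∈ Icc p q, 0 ≤ w x) (hc : 0 < c) (hcw : ∀ x ∈ Icc p q, c ≤ κ * w' x)
    (hfar : ∀ x ∈ Ioo p m₁ ∪ Ioo m₂ q, c * V x ≤ -(κ * (w x * deriv V x + w' x * V x)))
    (hC : 0 ≤ C) (hnear : ∀ x ∈ Ioo m₁ m₂, -C ≤ -(κ * (w x * deriv V x + w' x * V x)))
    (hV₁ : ∀ x ∈ Icc m₁ m₂, V x ≤ V₁) (hK : (∫ t in (0 : ℝ)..T, ∫ x in m₁..m₂, u (t, x) ^ 2) ≤ K) :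
    (∫ t in (0 : ℝ)..T, ∫ x in p..q,
        ((fderiv ℝ u (t, x) (1, 0) + κ * fderiv ℝ u (t, x) (0, 1)) ^ 2 + V x * u (t, x) ^ 2))
      ≤ ((∫ x in p..q, w x * eκ (0, x)) + (C + c * V₁) * K) / c := by
  have hpq : p ≤ q := hpm.trans (hm.trans hmq)
  have huc : Continuous u := (differentiable_of_contDiff_two hu).continuous
  have hΦc : Continuous fun z : ℝ × ℝ => fderiv ℝ u z (1, 0) + κ * fderiv ℝ u z (0, 1) :=
    (continuous_fderiv_apply hu (1, 0)).add (continuous_const.mul (continuous_fderiv_apply hu (0, 1)))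
  have hVc : Continuous fun z : ℝ × ℝ => V z.2 := hV.continuous.comp continuous_snd
  have hV'c : Continuous (deriv V) := hV.continuous_deriv le_rfl
  have hwc : Continuous w := continuous_iff_continuousAt.2 fun x => (hw x).continuousAt
  set src : ℝ × ℝ → ℝ := fun z =>
    κ * ((w z.2 * deriv V z.2 + w' z.2 * V z.2) * u z ^ 2
      - w' z.2 * (fderiv ℝ u z (1, 0) + κ * fderiv ℝ u z (0, 1)) ^ 2) with hsrc
  have hsrcc : Continuous src := by
    simp only [hsrc]
    fun_prop
  -- `∫∫ (−src) ≤ E_w(0)`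
  have hET : 0 ≤ ∫ x in p..q, w x * eκ (T, x) :=
    intervalIntegral.integral_nonneg hpq fun x hx => mul_nonneg (hw0 x hx) (by
      rw [heκ]; have := hV0 x; positivity)
  have hneg : (∫ t in (0 : ℝ)..T, ∫ x in p..q, -src (t, x)) ≤ ∫ x in p..q, w x * eκ (0, x) := by
    have : (∫ t in (0 : ℝ)..T, ∫ x in p..q, -src (t, x)) = -∫ t in (0 : ℝ)..T, ∫ x in p..q, src (t, x) := by
      rw [← intervalIntegral.integral_neg]
      exact intervalIntegral.integral_congr fun t _ => intervalIntegral.integral_neg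
    rw [this]
    change _ = ∫ t in (0 : ℝ)..T, ∫ x in p..q, src (t, x) at hkey
    linarith
  -- the good and the bad densities
  set good : ℝ × ℝ → ℝ := fun z =>
    c * (fderiv ℝ u z (1, 0) + κ * fderiv ℝ u z (0, 1)) ^ 2 + c * (V z.2 * u z ^ 2) with hgood
  set bad : ℝ × ℝ → ℝ := fun z => (C + c * V₁) * u z ^ 2 with hbad
  have hgoodc : Continuous good := (continuous_const.mul (hΦc.pow 2)).add
    (continuous_const.mul (hVc.mul (huc.pow 2)))
  have hbadc : Continuous bad := continuous_const.mul (huc.pow 2)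
  have hnsc : Continuous fun z => -src z := hsrcc.neg
  -- pointwise comparisons
  have hpt_far : ∀ t x, x ∈ Ioo p m₁ ∪ Ioo m₂ q → x ∈ Icc p q → good (t, x) ≤ -src (t, x) := by
    intro t x hx hx'
    have h1 := hfar x hx
    have h2 := hcw x hx'
    have h3 : 0 ≤ V x * u (t, x) ^ 2 := mul_nonneg (hV0 x) (sq_nonneg _)
    simp only [hgood, hsrc]
    nlinarith [sq_nonneg (fderiv ℝ u (t, x) (1, 0) + κ * fderiv ℝ u (t, x) (0, 1)),
      mul_le_mul_of_nonneg_right h1 (sq_nonneg (u (t, x))),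
      mul_le_mul_of_nonneg_right h2 (sq_nonneg (fderiv ℝ u (t, x) (1, 0) + κ * fderiv ℝ u (t, x) (0, 1)))]
  have hpt_near : ∀ t, ∀ x ∈ Ioo m₁ m₂, good (t, x) ≤ -src (t, x) + bad (t, x) := by
    intro t x hx
    have hx' : x ∈ Icc p q := ⟨hpm.trans hx.1.le, hx.2.le.trans hmq⟩
    have h1 := hnear x hx
    have h2 := hcw x hx'
    have h4 := hV₁ x ⟨hx.1.le, hx.2.le⟩
    have h3 : 0 ≤ u (t, x) ^ 2 := sq_nonneg _
    simp only [hgood, hsrc, hbad]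
    nlinarith [sq_nonneg (fderiv ℝ u (t, x) (1, 0) + κ * fderiv ℝ u (t, x) (0, 1)),
      mul_le_mul_of_nonneg_right h1 h3, mul_le_mul_of_nonneg_right h4 h3,
      mul_le_mul_of_nonneg_right h2 (sq_nonneg (fderiv ℝ u (t, x) (1, 0) + κ * fderiv ℝ u (t, x) (0, 1))),
      mul_nonneg hc.le (mul_nonneg (sub_nonneg.2 h4) h3)]
  -- integrate: `∫∫ good ≤ ∫∫ (−src) + ∫∫_{near} bad`
  have hI : (∫ t in (0 : ℝ)..T, ∫ x in p..q, good (t, x))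
      ≤ (∫ t in (0 : ℝ)..T, ∫ x in p..q, -src (t, x)) + ∫ t in (0 : ℝ)..T, ∫ x in m₁..m₂, bad (t, x) := by
    rw [integral2_split₀ hgoodc T p m₁ q, integral2_split₀ hgoodc T m₁ m₂ q,
      integral2_split₀ hnsc T p m₁ q, integral2_split₀ hnsc T m₁ m₂ q]
    have i1 := integral2_mono_on_Ioo hgoodc hnsc hT hpm fun t _ x hx => hpt_far t x (Or.inl hx)
      ⟨hx.1.le, hx.2.le.trans (hm.trans hmq)⟩
    have i3 := integral2_mono_on_Ioo hgoodc hnsc hT hmq fun t _ x hx => hpt_far t x (Or.inr hx)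
      ⟨hpm.trans (hm.trans hx.1.le), hx.2.le⟩
    have i2 := integral2_mono_on_Ioo (h := fun z => -src z + bad z) hgoodc (hnsc.add hbadc) hT hm
      fun t _ x hx => hpt_near t x hx
    rw [integral2_add₀ hnsc hbadc] at i2
    linarith
  have hbadK : (∫ t in (0 : ℝ)..T, ∫ x in m₁..m₂, bad (t, x)) ≤ (C + c * V₁) * K := by
    have h1 : (∫ t in (0 : ℝ)..T, ∫ x in m₁..m₂, bad (t, x))
        = (C + c * V₁) * ∫ t in (0 : ℝ)..T, ∫ x in m₁..m₂, u (t, x) ^ 2 :=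
      integral2_const_mul₀ (g := fun z => u z ^ 2) (C + c * V₁) T m₁ m₂
    have hV₁0 : 0 ≤ V₁ := (hV0 m₁).trans (hV₁ m₁ ⟨le_rfl, hm⟩)
    rw [h1]
    exact mul_le_mul_of_nonneg_left hK (by positivity)
  -- conclude
  have hgoal : (∫ t in (0 : ℝ)..T, ∫ x in p..q,
      ((fderiv ℝ u (t, x) (1, 0) + κ * fderiv ℝ u (t, x) (0, 1)) ^ 2 + V x * u (t, x) ^ 2))
      = (∫ t in (0 : ℝ)..T, ∫ x in p..q, good (t, x)) / c := by
    rw [eq_div_iff hc.ne', mul_comm]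
    refine Eq.trans (integral2_const_mul₀ (g := fun z =>
      (fderiv ℝ u z (1, 0) + κ * fderiv ℝ u z (0, 1)) ^ 2 + V z.2 * u z ^ 2) c T p q).symm ?_
    refine intervalIntegral.integral_congr fun t _ => intervalIntegral.integral_congr fun x _ => ?_
    simp only [hgood]
    ring
  rw [hgoal]
  exact div_le_div_of_nonneg_right (by linarith) hc.le

/-- **Registered sub-goal `stub_h4WeightedEstimate`** (crux stmt-FinalStateConjecture-14075, line
`isolated-kerr-connected-hull`, towards `stub_compactExhaustionOfLocalDecay`): the weighted null-energy
estimate on a box from the weighted transport identity. [folklore] -/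
theorem stub_h4WeightedEstimate : ∀ (u : ℝ × ℝ → ℝ) (V : ℝ → ℝ) (κ : ℝ), ContDiff ℝ 2 u →
    ContDiff ℝ 1 V → (∀ x, 0 ≤ V x) → ∀ (w w' : ℝ → ℝ), (∀ x, HasDerivAt w (w' x) x) → Continuous w' →
    ∀ (p m₁ m₂ q T c C V₁ K : ℝ), p ≤ m₁ → m₁ ≤ m₂ → m₂ ≤ q → 0 ≤ T →
    (∫ x in p..q, w x * ((fderiv ℝ u (T, x) (1, 0) + κ * fderiv ℝ u (T, x) (0, 1)) ^ 2
        + V x * u (T, x) ^ 2)) - (∫ x in p..q, w x * ((fderiv ℝ u (0, x) (1, 0)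
        + κ * fderiv ℝ u (0, x) (0, 1)) ^ 2 + V x * u (0, x) ^ 2))
      = (∫ t in (0:ℝ)..T, ∫ x in p..q, κ * ((w x * deriv V x + w' x * V x) * u (t, x) ^ 2
        - w' x * (fderiv ℝ u (t, x) (1, 0) + κ * fderiv ℝ u (t, x) (0, 1)) ^ 2)) →
    (∀ x ∈ Set.Icc p q, 0 ≤ w x) → 0 < c → (∀ x ∈ Set.Icc p q, c ≤ κ * w' x) →
    (∀ x ∈ Set.Ioo p m₁ ∪ Set.Ioo m₂ q, c * V x ≤ -(κ * (w x * deriv V x + w' x * V x))) → 0 ≤ C →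
    (∀ x ∈ Set.Ioo m₁ m₂, -C ≤ -(κ * (w x * deriv V x + w' x * V x))) →
    (∀ x ∈ Set.Icc m₁ m₂, V x ≤ V₁) → (∫ t in (0:ℝ)..T, ∫ x in m₁..m₂, u (t, x) ^ 2) ≤ K →
    (∫ t in (0:ℝ)..T, ∫ x in p..q, ((fderiv ℝ u (t, x) (1, 0) + κ * fderiv ℝ u (t, x) (0, 1)) ^ 2
        + V x * u (t, x) ^ 2))
      ≤ ((∫ x in p..q, w x * ((fderiv ℝ u (0, x) (1, 0) + κ * fderiv ℝ u (0, x) (0, 1)) ^ 2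
        + V x * u (0, x) ^ 2)) + (C + c * V₁) * K) / c :=
  fun u V κ hu hV hV0 _ _ hw hw' _ _ _ _ _ _ _ _ _ hpm hm hmq hT hkey hw0 hc hcw hfar hC hnear hV₁ hK =>
    weighted_box_estimate_Ioo hu hV hV0
      (eκ := fun z => (fderiv ℝ u z (1, 0) + κ * fderiv ℝ u z (0, 1)) ^ 2 + V z.2 * u z ^ 2)
      (fun _ => rfl) hw hw' hpm hm hmq hT hkey hw0 hc hcw hfar hC hnear hV₁ hK

end WaveEnergy

end

end Summit.FinalStateConjecture.FinalStateConjecture.Theorems
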